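/-
Copyright: the b2b-balaban T⁴-continuum CRUX team, row NE7b leaf lineage `t4-ne7b-formalise-leaf-05` (gen 151). Project licence.
-/
import Summits.QuantumFields.BalabanUV.T4Continuum.Spine.NE7b.ConvexTiltSuppliers
import Literature.MathematicalPhysics.QuantumFieldTheory.Balaban1983to89.B9SectEKernel
import Literature.MathematicalPhysics.QuantumFieldTheory.Balaban1983to89.B10Eq54QuadForm

/-!
# THE ROAD'S FIBRE FLOOR FROM PRINT'S COERCIVE FLUCTUATION OPERATOR, BY NAME: the tree's B9 Sect. E skeleton in MATRIX currency
# (`QGQInverse.Coercive (Cᵀ * Δ_k * C) γ₀′` — «`C*Δ_kC` … positive definite with a lower bound `γ₀ > 0` independent of `k` and `U`»,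
# [Bałaban, CMP 99 (1985)] (3.156)–(3.158) p. 428, `Δ_k` = the tree's `B10Eq54QuadForm.deltaK`) ⟹ the windowed convexity road's
# displayed letters on `EuclideanSpace ℝ (Fin N)`: the operator letter `σ‖v‖² ≤ ⟪v, Av⟫`, the HESSIAN floor
# `(2σ − h)‖v‖² ≤ D²(⟪·, A·⟫ + P)(x)[v, v]` ON a window, and the four product-window letters `(λ, a, A, b)` of a Gaussian-plus-
# perturbation fibre (row NE7b, node U5c; residual (R2′) family (2), letter (ℓ1) in Hessian currency; kernel JUNCTION lemmas)

Cell `pub-balaban`, sub-cell `t4`, spine estimate NE7b (`T4WeightBudget.RelWeightBound`; the cell's OWN estimate — NOT PRINTED in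
[Bałaban 1983–89], NOT PROVED).  Crux-route work under `Spine/NE7b/` by a row leaf (`t4-ne7b-formalise-leaf-05` gen 151) on the OWNER's
windowed convexity road (R-P1); NOTHING of Bałaban's is asserted; no `T4Continuum/Support` leaf typed; no `def`; zero `sorry`.  Imports
(all with hub oleans of 2026-08-23): the OWNER's `…NE7b.ConvexTiltSuppliers` (`hσ`, `gradient_quadratic`) and the reader cells' Literature
skeleton `….Balaban1983to89.B9SectEKernel` (r1) + dictionary `….B10Eq54QuadForm` (r07; `deltaK` = (3.156), `G1inv` = (3.128)).

WHY.  The pricing desk's R-P1 debt (PRICING-NE7b v101 §3¹⁰¹ (iii), v103): «BY VALUE NOTHING: no `c`, no `λ`, no window radius of Bałaban's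
is displayed anywhere on the row».  The road's fibre floor `λ` (`…HessianFormFirstOrder` `hH`, `…FibreWindowHessianBounds` §9 `hfib`,
`…ConvexWindowSuppliers` `hσ` — «coercivity of print's fluctuation covariance … (A3) readings») has a PRINT-SIDE OBJECT IN THE TREE, in
another currency: the reader cell's kernel skeleton of [13] CMP **99** Sect. E p. 428 (this lineage's reading R-A3-leaf05-g150-2, verified
first-hand by the desk, v102 F523) — `B9SectEKernel.gamma0_assembly` (the LOGIC of the `γ₀` claim, booked GAPS G-B9-09 «asserted, proved
nowhere in print», written repair `HOME/b2b-balaban-r1/SectE-interface-proof.md` §5 (Theorem E1: `γ₀(d,L) = c(d,L)∕640` modulo printed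
statements), analytic inputs (h1) (h2) (hJ) DISPLAYED) and `B9SectEKernel.coercive_sandwich_of_range` ((3.157)–(3.158)), concluding
`QGQInverse.Coercive M γ := ∀ x, γ·(x ⬝ᵥ x) ≤ x ⬝ᵥ (M *ᵥ x)` — real MATRIX currency.  The road speaks bounded operators on
`EuclideanSpace ℝ (Fin N)` and `iteratedFDeriv ℝ 2`.  THIS FILE is the junction: the road's `λ` can be written `λ := 2γ₀′ − h`, `γ₀′` the
Literature letter BY NAME for print's OWN matrix `Δ_k`, `h` the road's Hessian-small remainder (`…AnalyticHessianLetter`'s `2M∕δ²`).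

WHAT IS PROVED ([folklore]; `M̂ := Matrix.toEuclideanCLM M`; `A` a bounded operator symmetric in the real inner product, `hA`):
* §1 DICTIONARY — `dotProduct_self_eq_norm_sq`, `inner_toEuclideanCLM_symm` (the road's `hA`), **`coercive_iff_inner`** (`QGQInverse.Coercive
  M γ ↔ ∀ v, γ‖v‖² ≤ ⟪v, M̂ v⟫` — the road's `hσ`), `inner_le_of_form_le` (`B9SectEKernel.form_sandwich_le`'s upper shape ⟹ `⟪v, M̂ v⟫ ≤ γ₁‖v‖²`).
* §2 HESSIAN CURRENCY — `inner_fderiv_gradient_eq_iteratedFDeriv_two`, `contDiff_quadratic`, **`iteratedFDeriv_two_quadratic`**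
  (`D²(⟪·, A·⟫)(x)[v, w] = 2⟪v, A w⟫` via the OWNER's `gradient_quadratic`), `hessian_quadratic_lower ∕ _upper` (floor `2σ`, ceiling `2Γ`).
* §3 ON A WINDOW — **`hessianOn_quadratic_add_lower`** (`P` `C²` AT the points of `K`, `−h‖v‖² ≤ D²P(x)[v, v]` on `K` ⟹ `(2σ − h)‖v‖² ≤
  D²(⟪·, A·⟫ + P)(x)[v, v]` on `K` — Hessian twin of `…ConvexWindowSuppliers.firstOrderOn_quadratic_add_of_hessianOn`), `_upper`.
* §4 PRODUCT WINDOW `V(x, z) = ⟪z, A z⟫ + P(x, z)` — `contDiff_quadratic_snd(_add)`, `iteratedFDeriv_two_quadratic_snd(_add)` (`D²V(p)[ξ, η] =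
  2⟪ξ.2, A η.2⟫ + D²P(p)[ξ, η]`), `hessian_base_quadratic_snd_add` ∕ `hessian_mixed_quadratic_snd_add` (base and mixed blocks ARE `P`'s),
  `hessian_fibre_quadratic_snd_add_lower`, **`hessianLetters_quadratic_snd_add`**: P's letters (`−h`; `[a₀, a₁]`; `b`) on the fibre window
  through `x` ⟹ THE FOUR HYPOTHESES `hfib ∕ ha ∕ hA ∕ hb` of `…FibreWindowHessianBounds.hessian_twoSided_of_hessianLetters` for `V` VERBATIM at
  `(λ, a, A, b) := (2σ − h, a₀, a₁, b)` — §9's display reads `a₀ − b²∕(2σ − h) ≤ D²V⁺(x)[u, u] ≤ a₁` once `2σ > h`.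
* §5 THE JUNCTION BY NAME — `hessian_lower_of_coercive` (`QGQInverse.Coercive M γ`, `M` symmetric ⟹ floor `2γ` everywhere), `isSymm_sandwich`,
  **`hessian_lower_of_coercive_sandwich`** (hypotheses VERBATIM `B9SectEKernel.coercive_sandwich_of_range`'s + `T` symmetric ⊢ floor `2γ` for
  `Cᵀ T C`; the coercivity step IS that theorem), **`hessian_lower_of_gamma0_assembly`** (print's p. 428 sentence as ONE pipeline:
  `gamma0_assembly`'s hypotheses VERBATIM + sandwich letters ⊢ floor `2γ₀′ = 2((c − κ₂)∕κ₁ − θ)`), **`hessian_lower_of_deltaK`** (WHICH matrix: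
  `T := B10Eq54QuadForm.deltaK …` = print's (3.156), `(H, P)` instantiated as `H₁ = G₁Q_bᵀ(Q_bG₁Q_bᵀ)⁻¹` (3.129) and `(Q_bG₁Q_bᵀ)⁻¹`, so
  `QH = 1`, `SH = QᵀP` and `Δ_k` symmetric are THEOREMS from two invertibility letters and `K`, `C`, `Δ` symmetric),
  `hessianOn_lower_of_coercive_add` (+ remainder: `(2γ − h)` ON `K`).
* §6 toy `M = c·1`: `coercive_smul_one`, floor `2c` ATTAINED (`example`).

NOT HERE (honest): (h1), (h2), (hJ) BY VALUE and the two invertibility letters — displayed exactly as the Literature files display them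
(G-B9-09; Thm 3.11); print's matrices `K, C, Δ, Q, D, Q_b, E` at WHICH background `U` and window — the dictionary's binders, (A3) ∕ (A1c);
the `U = U_k(V′)` dependence of `Δ_k` across the base window is NOT in §4's constant-`A` model (absorbed in `P`: print's Lipschitz letter
[13] (3.84), tree `B9Eq384LaplaceALipschitzUniform`, × base radius inside `h, a₀, b`); the remainder `h` (`…AnalyticHessianLetter`, leaf-06);
the chart (`…HessianChartTransport`, leaf-01); the NE9 kit's complex-Hilbert `B9Thm311LaplaceAkPositiveDiagonal.exists_coercive_laplaceAk_…`
(`Δ_a` with `aQ*Q` — a third currency, not bridged); NC-NE7b-α UNRULED.  BY-NAME EFFECT ON THE WALL: NONE (the wall is (R2)).  On the desk's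
R-P1 debt (iii) the road's `λ` now has a NAMED print-side supplier in the tree; by value it is B9 Sect. E's displayed inputs, nothing more.
NE7b NOT PRINTED ∕ NOT PROVED; spine PROVED 0∕9; rung (B)+1 on a FINITE torus — NOT infinite volume, NOT the mass gap, NOT Clay.  HONEST DEPENDENCY:
continuum YM on T⁴ ⇐ BetaPertH ∧ nine spine estimates (0∕9 proved); BetaPertH ⇐ (D1) ∧ (D4) ∧ CAP+tail; G-an2-4 gates asym, D1 and NE2∕3∕4.
-/

set_option autoImplicit false

noncomputable section

open Real InnerProductSpace Set Matrix
open scoped RealInnerProductSpace Gradient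
open Literature.MathematicalPhysics.QuantumFieldTheory.Balaban1983to89 (QGQInverse.Coercive)
open Literature.MathematicalPhysics.QuantumFieldTheory.Balaban1983to89.B9SectEKernel (coercive_sandwich_of_range gamma0_assembly)
open Literature.MathematicalPhysics.QuantumFieldTheory.Balaban1983to89.B9Eq3152 (G1inv)
open Literature.MathematicalPhysics.QuantumFieldTheory.Balaban1983to89.B10Eq54QuadForm (delta1 deltaK deltaK_transpose G1inv_eq_delta1 G1inv_transpose)
open Summit.QuantumFields.BalabanUV.T4Continuum.NE7b.ConvexTiltSuppliers (hasGradientAt_quadratic gradient_quadratic)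

namespace Summit.QuantumFields.BalabanUV.T4Continuum.NE7b.CoerciveFluctuationFloor

variable {N : ℕ}

/-! ## §1 The dictionary: matrix currency on `Fin N → ℝ` ↔ operator currency on `EuclideanSpace ℝ (Fin N)` -/

/-- `v ⬝ᵥ v = ‖v‖²` for the coordinates of a Euclidean vector. [folklore] -/
theorem dotProduct_self_eq_norm_sq (v : EuclideanSpace ℝ (Fin N)) : v ⬝ᵥ v = ‖v‖ ^ 2 := by
  rw [EuclideanSpace.real_norm_sq_eq, dotProduct]
  exact Finset.sum_congr rfl fun i _ => by ring

/-- The operator of a SYMMETRIC matrix is symmetric in the real inner product: `⟪M̂ v, w⟫ = ⟪v, M̂ w⟫` — the road's `hA` letter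
(`…ConvexTiltSuppliers`, `…ConvexWindowSuppliers`). [folklore] -/
theorem inner_toEuclideanCLM_symm {M : Matrix (Fin N) (Fin N) ℝ} (hM : M.IsSymm) (v w : EuclideanSpace ℝ (Fin N)) :
    ⟪toEuclideanCLM (𝕜 := ℝ) M v, w⟫ = ⟪v, toEuclideanCLM (𝕜 := ℝ) M w⟫ := by
  rw [real_inner_comm, inner_toEuclideanCLM, inner_toEuclideanCLM, dotProduct_mulVec, ← mulVec_transpose, hM.eq,
    dotProduct_comm]

/-- **MATRIX COERCIVITY IS THE ROAD'S OPERATOR LETTER**: `QGQInverse.Coercive M γ` (the B9 Sect. E skeleton's currency on `Fin N → ℝ`)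
iff `γ‖v‖² ≤ ⟪v, M̂ v⟫` for every Euclidean `v` — the `hσ` letter of `…ConvexTiltSuppliers` ∕ `…ConvexWindowSuppliers`. [folklore] -/
theorem coercive_iff_inner (M : Matrix (Fin N) (Fin N) ℝ) (γ : ℝ) :
    QGQInverse.Coercive M γ ↔ ∀ v : EuclideanSpace ℝ (Fin N), γ * ‖v‖ ^ 2 ≤ ⟪v, toEuclideanCLM (𝕜 := ℝ) M v⟫ := by
  constructor
  · intro h v
    rw [inner_toEuclideanCLM, ← dotProduct_self_eq_norm_sq]
    exact h _
  · intro h x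
    have hx := h (WithLp.toLp 2 x)
    rw [inner_toEuclideanCLM, ← dotProduct_self_eq_norm_sq] at hx
    simpa using hx

/-- The UPPER form bound `u ⬝ᵥ M u ≤ γ₁·(u ⬝ᵥ u)` (`B9SectEKernel.form_sandwich_le`'s shape; print's «`γ₁` is an upper bound of
`C*Δ_kC`», [Bałaban CMP 102] p. 272) is the operator ceiling `⟪v, M̂ v⟫ ≤ γ₁‖v‖²`. [folklore] -/
theorem inner_le_of_form_le {M : Matrix (Fin N) (Fin N) ℝ} {γ₁ : ℝ} (h : ∀ u : Fin N → ℝ, u ⬝ᵥ (M *ᵥ u) ≤ γ₁ * (u ⬝ᵥ u))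
    (v : EuclideanSpace ℝ (Fin N)) : ⟪v, toEuclideanCLM (𝕜 := ℝ) M v⟫ ≤ γ₁ * ‖v‖ ^ 2 := by
  rw [inner_toEuclideanCLM, ← dotProduct_self_eq_norm_sq]
  exact h _

/-! ## §2 The quadratic form of a symmetric operator in HESSIAN currency: `D²(⟪·, A·⟫)(x)[v, w] = 2⟪v, A w⟫` -/

/-- `⟪w, D(∇q)(x) v⟫ = D²q(x)[v, w]` (no differentiability asked; `∇q` is `Dq` through the Riesz isometry).  [folklore] (the tree's
`Literature.Analysis.FluidPDE.DeviatoricHessian` has this identity in its own import world; restated to keep this file's imports in the row) -/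
theorem inner_fderiv_gradient_eq_iteratedFDeriv_two (q : EuclideanSpace ℝ (Fin N) → ℝ) (x v w : EuclideanSpace ℝ (Fin N)) :
    ⟪w, fderiv ℝ (gradient q) x v⟫ = iteratedFDeriv ℝ 2 q x ![v, w] := by
  have h : gradient q = (InnerProductSpace.toDual ℝ (EuclideanSpace ℝ (Fin N))).symm ∘ fderiv ℝ q := rfl
  have h2 : fderiv ℝ (gradient q) x v =
      (InnerProductSpace.toDual ℝ (EuclideanSpace ℝ (Fin N))).symm (fderiv ℝ (fderiv ℝ q) x v) := by
    rw [h, LinearIsometryEquiv.comp_fderiv]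
    rfl
  rw [h2, real_inner_comm, InnerProductSpace.toDual_symm_apply, iteratedFDeriv_two_apply]
  simp only [Matrix.cons_val_zero, Matrix.cons_val_one]

/-- The quadratic form of a bounded operator is `C^∞`. [folklore] -/
theorem contDiff_quadratic (A : EuclideanSpace ℝ (Fin N) →L[ℝ] EuclideanSpace ℝ (Fin N)) {k : WithTop ℕ∞} :
    ContDiff ℝ k (fun z : EuclideanSpace ℝ (Fin N) => ⟪z, A z⟫) :=
  contDiff_id.inner ℝ A.contDiff

/-- **THE HESSIAN OF `⟪·, A·⟫` IS `2A`**: `D²(z ↦ ⟪z, A z⟫)(x)[v, w] = 2⟪v, A w⟫` for `A` symmetric, at every `x`. [folklore] -/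
theorem iteratedFDeriv_two_quadratic (A : EuclideanSpace ℝ (Fin N) →L[ℝ] EuclideanSpace ℝ (Fin N))
    (hA : ∀ v w : EuclideanSpace ℝ (Fin N), ⟪A v, w⟫ = ⟪v, A w⟫) (x v w : EuclideanSpace ℝ (Fin N)) :
    iteratedFDeriv ℝ 2 (fun z : EuclideanSpace ℝ (Fin N) => ⟪z, A z⟫) x ![v, w] = 2 * ⟪v, A w⟫ := by
  rw [← inner_fderiv_gradient_eq_iteratedFDeriv_two]
  have hg : gradient (fun z : EuclideanSpace ℝ (Fin N) => ⟪z, A z⟫) = fun z => ((2 : ℝ) • A) z := by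
    funext z; rw [gradient_quadratic A hA z, _root_.smul_apply]
  rw [hg, ContinuousLinearMap.fderiv, _root_.smul_apply, real_inner_smul_right, ← hA v w, real_inner_comm]

/-- **OPERATOR LETTER ⟹ HESSIAN FLOOR, EVERYWHERE**: `σ‖v‖² ≤ ⟪v, Av⟫` (`A` symmetric) ⟹ `2σ‖v‖² ≤ D²(⟪·, A·⟫)(x)[v, v]` at every
`x` — the `hH` ∕ `hfib` shape of `…HessianFormFirstOrder` and `…FibreWindowHessianBounds` §9 with `λ = 2σ`, on any window. [folklore] -/
theorem hessian_quadratic_lower (A : EuclideanSpace ℝ (Fin N) →L[ℝ] EuclideanSpace ℝ (Fin N))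
    (hA : ∀ v w : EuclideanSpace ℝ (Fin N), ⟪A v, w⟫ = ⟪v, A w⟫) {σ : ℝ}
    (hσ : ∀ v : EuclideanSpace ℝ (Fin N), σ * ‖v‖ ^ 2 ≤ ⟪v, A v⟫) (x v : EuclideanSpace ℝ (Fin N)) :
    2 * σ * ‖v‖ ^ 2 ≤ iteratedFDeriv ℝ 2 (fun z : EuclideanSpace ℝ (Fin N) => ⟪z, A z⟫) x ![v, v] := by
  rw [iteratedFDeriv_two_quadratic A hA]
  nlinarith [hσ v]

/-- … and the ceiling: `⟪v, Av⟫ ≤ Γ‖v‖²` ⟹ `D²(⟪·, A·⟫)(x)[v, v] ≤ 2Γ‖v‖²`. [folklore] -/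
theorem hessian_quadratic_upper (A : EuclideanSpace ℝ (Fin N) →L[ℝ] EuclideanSpace ℝ (Fin N))
    (hA : ∀ v w : EuclideanSpace ℝ (Fin N), ⟪A v, w⟫ = ⟪v, A w⟫) {Γ : ℝ}
    (hΓ : ∀ v : EuclideanSpace ℝ (Fin N), ⟪v, A v⟫ ≤ Γ * ‖v‖ ^ 2) (x v : EuclideanSpace ℝ (Fin N)) :
    iteratedFDeriv ℝ 2 (fun z : EuclideanSpace ℝ (Fin N) => ⟪z, A z⟫) x ![v, v] ≤ 2 * Γ * ‖v‖ ^ 2 := by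
  rw [iteratedFDeriv_two_quadratic A hA]
  nlinarith [hΓ v]

/-! ## §3 Gaussian plus perturbation in Hessian currency, ON a window: `(2σ − h)‖v‖² ≤ D²(⟪·, A·⟫ + P)(x)[v, v] ≤ (2Γ + h′)‖v‖²` -/

/-- **COERCIVE QUADRATIC FORM PLUS A HESSIAN-SMALL PERTURBATION, ON THE WINDOW** (Hessian twin of
`…ConvexWindowSuppliers.firstOrderOn_quadratic_add_of_hessianOn`): `σ‖v‖² ≤ ⟪v, Av⟫` (`A` symmetric), `P` `C²` AT the points of `K` (what
`…AnalyticHessianLetter.contDiffOn_re_comp` gives on the open preimage of the analyticity domain), `−h‖v‖² ≤ D²P(x)[v, v]` on `K` ⟹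
`(2σ − h)‖v‖² ≤ D²(⟪·, A·⟫ + P)(x)[v, v]` on `K`. [folklore] -/
theorem hessianOn_quadratic_add_lower (A : EuclideanSpace ℝ (Fin N) →L[ℝ] EuclideanSpace ℝ (Fin N))
    (hA : ∀ v w : EuclideanSpace ℝ (Fin N), ⟪A v, w⟫ = ⟪v, A w⟫) {σ h : ℝ} {K : Set (EuclideanSpace ℝ (Fin N))}
    (hσ : ∀ v : EuclideanSpace ℝ (Fin N), σ * ‖v‖ ^ 2 ≤ ⟪v, A v⟫) {P : EuclideanSpace ℝ (Fin N) → ℝ}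
    (hP : ∀ x ∈ K, ContDiffAt ℝ 2 P x)
    (hH : ∀ x ∈ K, ∀ v : EuclideanSpace ℝ (Fin N), -h * ‖v‖ ^ 2 ≤ iteratedFDeriv ℝ 2 P x ![v, v]) :
    ∀ x ∈ K, ∀ v : EuclideanSpace ℝ (Fin N),
      (2 * σ - h) * ‖v‖ ^ 2 ≤ iteratedFDeriv ℝ 2 (fun z : EuclideanSpace ℝ (Fin N) => ⟪z, A z⟫ + P z) x ![v, v] := by
  intro x hx v
  have e : (fun z : EuclideanSpace ℝ (Fin N) => ⟪z, A z⟫ + P z) = (fun z : EuclideanSpace ℝ (Fin N) => ⟪z, A z⟫) + P := rfl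
  rw [e, iteratedFDeriv_add_apply (contDiff_quadratic A).contDiffAt (hP x hx), _root_.add_apply]
  have h1 := hessian_quadratic_lower A hA hσ x v
  have h2 := hH x hx v
  linarith

/-- The ceiling twin: `⟪v, Av⟫ ≤ Γ‖v‖²`, `D²P(x)[v, v] ≤ h′‖v‖²` on `K` ⟹ `D²(⟪·, A·⟫ + P)(x)[v, v] ≤ (2Γ + h′)‖v‖²` on `K`. [folklore] -/
theorem hessianOn_quadratic_add_upper (A : EuclideanSpace ℝ (Fin N) →L[ℝ] EuclideanSpace ℝ (Fin N))
    (hA : ∀ v w : EuclideanSpace ℝ (Fin N), ⟪A v, w⟫ = ⟪v, A w⟫) {Γ h' : ℝ} {K : Set (EuclideanSpace ℝ (Fin N))}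
    (hΓ : ∀ v : EuclideanSpace ℝ (Fin N), ⟪v, A v⟫ ≤ Γ * ‖v‖ ^ 2) {P : EuclideanSpace ℝ (Fin N) → ℝ}
    (hP : ∀ x ∈ K, ContDiffAt ℝ 2 P x)
    (hH : ∀ x ∈ K, ∀ v : EuclideanSpace ℝ (Fin N), iteratedFDeriv ℝ 2 P x ![v, v] ≤ h' * ‖v‖ ^ 2) :
    ∀ x ∈ K, ∀ v : EuclideanSpace ℝ (Fin N),
      iteratedFDeriv ℝ 2 (fun z : EuclideanSpace ℝ (Fin N) => ⟪z, A z⟫ + P z) x ![v, v] ≤ (2 * Γ + h') * ‖v‖ ^ 2 := by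
  intro x hx v
  have e : (fun z : EuclideanSpace ℝ (Fin N) => ⟪z, A z⟫ + P z) = (fun z : EuclideanSpace ℝ (Fin N) => ⟪z, A z⟫) + P := rfl
  rw [e, iteratedFDeriv_add_apply (contDiff_quadratic A).contDiffAt (hP x hx), _root_.add_apply]
  have h1 := hessian_quadratic_upper A hA hΓ x v
  have h2 := hH x hx v
  linarith

/-! ## §4 The Gaussian-plus-perturbation FIBRE of a product window: the four letters `(λ, a₀, a₁, b)` of
`…FibreWindowHessianBounds` §9 for `V(x, z) = ⟪z, A z⟫ + P(x, z)` are `(2σ − h, a₀, a₁, b)` — P's letters, the floor shifted by `2σ` -/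

section ProductWindow

variable {m : ℕ}

/-- The quadratic form read on the fibre coordinate of a product is `C^∞`. [folklore] -/
theorem contDiff_quadratic_snd (A : EuclideanSpace ℝ (Fin N) →L[ℝ] EuclideanSpace ℝ (Fin N)) {k : WithTop ℕ∞} :
    ContDiff ℝ k (fun p : EuclideanSpace ℝ (Fin m) × EuclideanSpace ℝ (Fin N) => ⟪p.2, A p.2⟫) :=
  (contDiff_quadratic A).comp contDiff_snd

/-- `V(x, z) = ⟪z, A z⟫ + P(x, z)` is `C²` when `P` is. [folklore] -/
theorem contDiff_quadratic_snd_add (A : EuclideanSpace ℝ (Fin N) →L[ℝ] EuclideanSpace ℝ (Fin N))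
    {P : EuclideanSpace ℝ (Fin m) × EuclideanSpace ℝ (Fin N) → ℝ} {k : WithTop ℕ∞} (hP : ContDiff ℝ k P) :
    ContDiff ℝ k (fun p : EuclideanSpace ℝ (Fin m) × EuclideanSpace ℝ (Fin N) => ⟪p.2, A p.2⟫ + P p) :=
  (contDiff_quadratic_snd A).add hP

/-- **THE JOINT HESSIAN OF THE FIBRE QUADRATIC FORM**: `D²((x, z) ↦ ⟪z, A z⟫)(p)[ξ, η] = 2⟪ξ.2, A η.2⟫` (`A` symmetric). [folklore] -/
theorem iteratedFDeriv_two_quadratic_snd (A : EuclideanSpace ℝ (Fin N) →L[ℝ] EuclideanSpace ℝ (Fin N))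
    (hA : ∀ v w : EuclideanSpace ℝ (Fin N), ⟪A v, w⟫ = ⟪v, A w⟫) (p ξ η : EuclideanSpace ℝ (Fin m) × EuclideanSpace ℝ (Fin N)) :
    iteratedFDeriv ℝ 2 (fun p : EuclideanSpace ℝ (Fin m) × EuclideanSpace ℝ (Fin N) => ⟪p.2, A p.2⟫) p ![ξ, η] = 2 * ⟪ξ.2, A η.2⟫ := by
  have hc : (fun p : EuclideanSpace ℝ (Fin m) × EuclideanSpace ℝ (Fin N) => ⟪p.2, A p.2⟫) =
      (fun z : EuclideanSpace ℝ (Fin N) => ⟪z, A z⟫) ∘ (ContinuousLinearMap.snd ℝ (EuclideanSpace ℝ (Fin m)) (EuclideanSpace ℝ (Fin N))) := rfl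
  rw [hc, ContinuousLinearMap.iteratedFDeriv_comp_right _ (contDiff_quadratic A (k := 2)) _ le_rfl,
    ContinuousMultilinearMap.compContinuousLinearMap_apply]
  have hv : (fun i : Fin 2 => (ContinuousLinearMap.snd ℝ (EuclideanSpace ℝ (Fin m)) (EuclideanSpace ℝ (Fin N))) (![ξ, η] i)) =
      ![ξ.2, η.2] := by
    funext i; fin_cases i <;> rfl
  rw [hv, iteratedFDeriv_two_quadratic A hA]

/-- The joint Hessian of `V = ⟪·₂, A ·₂⟫ + P` splits: `D²V(p)[ξ, η] = 2⟪ξ.2, A η.2⟫ + D²P(p)[ξ, η]`. [folklore] -/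
theorem iteratedFDeriv_two_quadratic_snd_add (A : EuclideanSpace ℝ (Fin N) →L[ℝ] EuclideanSpace ℝ (Fin N))
    (hA : ∀ v w : EuclideanSpace ℝ (Fin N), ⟪A v, w⟫ = ⟪v, A w⟫) {P : EuclideanSpace ℝ (Fin m) × EuclideanSpace ℝ (Fin N) → ℝ}
    (hP : ContDiff ℝ 2 P) (p ξ η : EuclideanSpace ℝ (Fin m) × EuclideanSpace ℝ (Fin N)) :
    iteratedFDeriv ℝ 2 (fun p : EuclideanSpace ℝ (Fin m) × EuclideanSpace ℝ (Fin N) => ⟪p.2, A p.2⟫ + P p) p ![ξ, η] =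
      2 * ⟪ξ.2, A η.2⟫ + iteratedFDeriv ℝ 2 P p ![ξ, η] := by
  have e : (fun p : EuclideanSpace ℝ (Fin m) × EuclideanSpace ℝ (Fin N) => ⟪p.2, A p.2⟫ + P p) =
      (fun p : EuclideanSpace ℝ (Fin m) × EuclideanSpace ℝ (Fin N) => ⟪p.2, A p.2⟫) + P := rfl
  rw [e, iteratedFDeriv_add_apply (contDiff_quadratic_snd A).contDiffAt hP.contDiffAt, _root_.add_apply,
    iteratedFDeriv_two_quadratic_snd A hA]

/-- **THE BASE BLOCK IS P's**: `D²V(x, y)[(u, 0), (u, 0)] = D²P(x, y)[(u, 0), (u, 0)]` (in the `fderiv ∘ fderiv` currency of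
`…FibreWindowHessianBounds` §9's `ha` ∕ `hA`). [folklore] -/
theorem hessian_base_quadratic_snd_add (A : EuclideanSpace ℝ (Fin N) →L[ℝ] EuclideanSpace ℝ (Fin N))
    (hA : ∀ v w : EuclideanSpace ℝ (Fin N), ⟪A v, w⟫ = ⟪v, A w⟫) {P : EuclideanSpace ℝ (Fin m) × EuclideanSpace ℝ (Fin N) → ℝ}
    (hP : ContDiff ℝ 2 P) (x u : EuclideanSpace ℝ (Fin m)) (y : EuclideanSpace ℝ (Fin N)) :
    fderiv ℝ (fderiv ℝ (fun p : EuclideanSpace ℝ (Fin m) × EuclideanSpace ℝ (Fin N) => ⟪p.2, A p.2⟫ + P p)) (x, y) (u, 0) (u, 0) =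
      fderiv ℝ (fderiv ℝ P) (x, y) (u, 0) (u, 0) := by
  have h := iteratedFDeriv_two_quadratic_snd_add A hA hP (x, y) (u, 0) (u, 0)
  rw [iteratedFDeriv_two_apply, iteratedFDeriv_two_apply] at h
  simpa using h

/-- **THE MIXED BLOCK IS P's**: `D²V(x, y)[(0, v), (u, 0)] = D²P(x, y)[(0, v), (u, 0)]` (the `hb` currency of §9). [folklore] -/
theorem hessian_mixed_quadratic_snd_add (A : EuclideanSpace ℝ (Fin N) →L[ℝ] EuclideanSpace ℝ (Fin N))
    (hA : ∀ v w : EuclideanSpace ℝ (Fin N), ⟪A v, w⟫ = ⟪v, A w⟫) {P : EuclideanSpace ℝ (Fin m) × EuclideanSpace ℝ (Fin N) → ℝ}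
    (hP : ContDiff ℝ 2 P) (x u : EuclideanSpace ℝ (Fin m)) (y v : EuclideanSpace ℝ (Fin N)) :
    fderiv ℝ (fderiv ℝ (fun p : EuclideanSpace ℝ (Fin m) × EuclideanSpace ℝ (Fin N) => ⟪p.2, A p.2⟫ + P p)) (x, y) (0, v) (u, 0) =
      fderiv ℝ (fderiv ℝ P) (x, y) (0, v) (u, 0) := by
  have h := iteratedFDeriv_two_quadratic_snd_add A hA hP (x, y) (0, v) (u, 0)
  rw [iteratedFDeriv_two_apply, iteratedFDeriv_two_apply] at h
  simpa using h

/-- **THE FIBRE SLICE IS `⟪·, A·⟫ + P(x, ·)`**: `(2σ − h)‖v‖² ≤ D²(V(x, ·))(y)[v, v]` for `y ∈ F` from P's fibre letter `−h` on `F` —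
the `hfib` hypothesis of `…FibreWindowHessianBounds` §9 with `λ = 2σ − h`. [folklore] -/
theorem hessian_fibre_quadratic_snd_add_lower (A : EuclideanSpace ℝ (Fin N) →L[ℝ] EuclideanSpace ℝ (Fin N))
    (hA : ∀ v w : EuclideanSpace ℝ (Fin N), ⟪A v, w⟫ = ⟪v, A w⟫) {σ h : ℝ}
    (hσ : ∀ v : EuclideanSpace ℝ (Fin N), σ * ‖v‖ ^ 2 ≤ ⟪v, A v⟫) {P : EuclideanSpace ℝ (Fin m) × EuclideanSpace ℝ (Fin N) → ℝ}
    (hP : ContDiff ℝ 2 P) {F : Set (EuclideanSpace ℝ (Fin N))} (x : EuclideanSpace ℝ (Fin m))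
    (hfibP : ∀ y ∈ F, ∀ v : EuclideanSpace ℝ (Fin N), -h * ‖v‖ ^ 2 ≤ iteratedFDeriv ℝ 2 (fun z => P (x, z)) y ![v, v]) :
    ∀ y ∈ F, ∀ v : EuclideanSpace ℝ (Fin N), (2 * σ - h) * ‖v‖ ^ 2 ≤
      iteratedFDeriv ℝ 2 (fun z => (fun p : EuclideanSpace ℝ (Fin m) × EuclideanSpace ℝ (Fin N) => ⟪p.2, A p.2⟫ + P p) (x, z)) y ![v, v] :=
  hessianOn_quadratic_add_lower A hA hσ (fun _ _ => (hP.comp (contDiff_prodMk_right x)).contDiffAt) hfibP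

/-- **P's FOUR LETTERS ARE V's, WITH THE FIBRE FLOOR SHIFTED BY `2σ`** — the hypotheses `hfib`, `ha`, `hA`, `hb` of
`…FibreWindowHessianBounds.hessian_twoSided_of_hessianLetters` for `V = ⟪·₂, A ·₂⟫ + P` at `(λ, a, A, b) := (2σ − h, a₀, a₁, b)`, read off the
same four letters of `P` on the fibre window `F` through `x` (`V ∈ C²` by `contDiff_quadratic_snd_add`): §9 then displays
`a₀ − b²∕(2σ − h) ≤ D²V⁺(x)[u, u] ≤ a₁` once `2σ > h`. [folklore] -/
theorem hessianLetters_quadratic_snd_add (A : EuclideanSpace ℝ (Fin N) →L[ℝ] EuclideanSpace ℝ (Fin N))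
    (hA : ∀ v w : EuclideanSpace ℝ (Fin N), ⟪A v, w⟫ = ⟪v, A w⟫) {σ h : ℝ}
    (hσ : ∀ v : EuclideanSpace ℝ (Fin N), σ * ‖v‖ ^ 2 ≤ ⟪v, A v⟫) {P : EuclideanSpace ℝ (Fin m) × EuclideanSpace ℝ (Fin N) → ℝ}
    (hP : ContDiff ℝ 2 P) {F : Set (EuclideanSpace ℝ (Fin N))} (x u : EuclideanSpace ℝ (Fin m)) {a₀ a₁ b : ℝ}
    (hfibP : ∀ y ∈ F, ∀ v : EuclideanSpace ℝ (Fin N), -h * ‖v‖ ^ 2 ≤ iteratedFDeriv ℝ 2 (fun z => P (x, z)) y ![v, v])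
    (haP : ∀ y ∈ F, a₀ ≤ fderiv ℝ (fderiv ℝ P) (x, y) (u, 0) (u, 0))
    (hAP : ∀ y ∈ F, fderiv ℝ (fderiv ℝ P) (x, y) (u, 0) (u, 0) ≤ a₁)
    (hbP : ∀ y ∈ F, ∀ v : EuclideanSpace ℝ (Fin N), |fderiv ℝ (fderiv ℝ P) (x, y) (0, v) (u, 0)| ≤ b * ‖v‖) :
    (∀ y ∈ F, ∀ v : EuclideanSpace ℝ (Fin N), (2 * σ - h) * ‖v‖ ^ 2 ≤
        iteratedFDeriv ℝ 2 (fun z => (fun p : EuclideanSpace ℝ (Fin m) × EuclideanSpace ℝ (Fin N) => ⟪p.2, A p.2⟫ + P p) (x, z)) y ![v, v]) ∧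
      (∀ y ∈ F, a₀ ≤ fderiv ℝ (fderiv ℝ (fun p : EuclideanSpace ℝ (Fin m) × EuclideanSpace ℝ (Fin N) => ⟪p.2, A p.2⟫ + P p))
        (x, y) (u, 0) (u, 0)) ∧
      (∀ y ∈ F, fderiv ℝ (fderiv ℝ (fun p : EuclideanSpace ℝ (Fin m) × EuclideanSpace ℝ (Fin N) => ⟪p.2, A p.2⟫ + P p))
        (x, y) (u, 0) (u, 0) ≤ a₁) ∧
      (∀ y ∈ F, ∀ v : EuclideanSpace ℝ (Fin N), |fderiv ℝ (fderiv ℝ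
        (fun p : EuclideanSpace ℝ (Fin m) × EuclideanSpace ℝ (Fin N) => ⟪p.2, A p.2⟫ + P p)) (x, y) (0, v) (u, 0)| ≤ b * ‖v‖) := by
  refine ⟨hessian_fibre_quadratic_snd_add_lower A hA hσ hP x hfibP, fun y hy => ?_, fun y hy => ?_, fun y hy v => ?_⟩
  · rw [hessian_base_quadratic_snd_add A hA hP]; exact haP y hy
  · rw [hessian_base_quadratic_snd_add A hA hP]; exact hAP y hy
  · rw [hessian_mixed_quadratic_snd_add A hA hP]; exact hbP y hy v

end ProductWindow

/-! ## §5 THE JUNCTION BY NAME: the tree's B9 Sect. E skeleton (matrix currency) supplies the floor -/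

section Junction

/-- **A COERCIVE SYMMETRIC MATRIX GIVES THE HESSIAN FLOOR `2γ` EVERYWHERE**: `QGQInverse.Coercive M γ`, `M` symmetric ⟹
`2γ‖v‖² ≤ D²(z ↦ ⟪z, M̂ z⟫)(x)[v, v]` at every `x`, for the operator `M̂ = Matrix.toEuclideanCLM M`. [folklore] -/
theorem hessian_lower_of_coercive {M : Matrix (Fin N) (Fin N) ℝ} (hM : M.IsSymm) {γ : ℝ} (hγ : QGQInverse.Coercive M γ)
    (x v : EuclideanSpace ℝ (Fin N)) :
    2 * γ * ‖v‖ ^ 2 ≤ iteratedFDeriv ℝ 2 (fun z : EuclideanSpace ℝ (Fin N) => ⟪z, toEuclideanCLM (𝕜 := ℝ) M z⟫) x ![v, v] :=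
  hessian_quadratic_lower _ (inner_toEuclideanCLM_symm hM) ((coercive_iff_inner M γ).1 hγ) x v

/-- `Cᵀ T C` is symmetric when `T` is. [folklore] -/
theorem isSymm_sandwich {K : ℕ} {T : Matrix (Fin K) (Fin K) ℝ} (hT : T.IsSymm) (C : Matrix (Fin K) (Fin N) ℝ) :
    (Cᵀ * T * C).IsSymm := by
  rw [Matrix.IsSymm, transpose_mul, transpose_mul, transpose_transpose, hT.eq, Matrix.mul_assoc]

/-- **PRINT's SANDWICH (3.157)–(3.158), BY NAME, INTO THE ROAD's DISPLAY.**  Hypotheses VERBATIM those of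
`B9SectEKernel.coercive_sandwich_of_range` (at `Fin K`, `Fin N`): `C` (print's `C : B̃ ↦ B`) is `good`-valued and norm non-decreasing, `T`
(print's `Δ_k`) is `≥ γ ≥ 0` on `good`; plus `T` symmetric ⊢ the form of `Cᵀ T C` has HESSIAN floor `2γ` at every point of the road's fibre
`EuclideanSpace ℝ (Fin N)` — the `hfib` ∕ `hH` letter with `λ = 2γ`. [folklore] (the coercivity step IS `coercive_sandwich_of_range`) -/
theorem hessian_lower_of_coercive_sandwich {K : ℕ} (T : Matrix (Fin K) (Fin K) ℝ) (C : Matrix (Fin K) (Fin N) ℝ)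
    (good : (Fin K → ℝ) → Prop) {γ : ℝ} (hγ : 0 ≤ γ) (hgood : ∀ v : Fin N → ℝ, good (C *ᵥ v))
    (hC : ∀ v : Fin N → ℝ, v ⬝ᵥ v ≤ (C *ᵥ v) ⬝ᵥ (C *ᵥ v))
    (hT : ∀ B : Fin K → ℝ, good B → γ * (B ⬝ᵥ B) ≤ B ⬝ᵥ (T *ᵥ B)) (hTs : T.IsSymm) (x v : EuclideanSpace ℝ (Fin N)) :
    2 * γ * ‖v‖ ^ 2 ≤
      iteratedFDeriv ℝ 2 (fun z : EuclideanSpace ℝ (Fin N) => ⟪z, toEuclideanCLM (𝕜 := ℝ) (Cᵀ * T * C) z⟫) x ![v, v] :=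
  hessian_lower_of_coercive (isSymm_sandwich hTs C) (coercive_sandwich_of_range T C good hγ hgood hC hT) x v

/-- **PRINT's p. 428 SENTENCE AS ONE PIPELINE** («… with a lower bound `γ₀ > 0` independent of `k` and `U` … Localizing the operators
… we can prove it» — G-B9-09, the repair's logic kernel-checked as `B9SectEKernel.gamma0_assembly`): hypotheses = `gamma0_assembly`'s
VERBATIM (`QH = 1`, `SH = QᵀP`; (h1) covariant Stokes, (h2) covariant Lemma 2.4′ on `good`, (hJ)) + the sandwich's + `P − a − Jm` symmetric
+ `0 ≤ γ₀′ := (c − κ₂)∕κ₁ − θ` ⊢ floor `2γ₀′` for the form of `Cᵀ(P − a − Jm)C`.  By value NOTHING of print: (h1) (h2) (hJ) displayed. [folklore] -/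
theorem hessian_lower_of_gamma0_assembly {n₀ K : ℕ} (K₀ : Matrix (Fin n₀) (Fin n₀) ℝ) (Q : Matrix (Fin K) (Fin n₀) ℝ) (a : ℝ)
    (H : Matrix (Fin n₀) (Fin K) ℝ) (P Jm : Matrix (Fin K) (Fin K) ℝ) (hQH : Q * H = 1)
    (hSH : (K₀ + a • (Qᵀ * Q)) * H = Qᵀ * P) (good : (Fin K → ℝ) → Prop) (Φ : (Fin K → ℝ) → ℝ) {κ₁ κ₂ c θ : ℝ}
    (hκ₁ : 0 < κ₁) (h1 : ∀ A : Fin n₀ → ℝ, Φ (Q *ᵥ A) ≤ κ₁ * (A ⬝ᵥ (K₀ *ᵥ A)) + κ₂ * ((Q *ᵥ A) ⬝ᵥ (Q *ᵥ A)))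
    (h2 : ∀ B : Fin K → ℝ, good B → c * (B ⬝ᵥ B) ≤ Φ B) (hJ : ∀ B : Fin K → ℝ, |B ⬝ᵥ (Jm *ᵥ B)| ≤ θ * (B ⬝ᵥ B))
    (C : Matrix (Fin K) (Fin N) ℝ) (hgood : ∀ v : Fin N → ℝ, good (C *ᵥ v))
    (hC : ∀ v : Fin N → ℝ, v ⬝ᵥ v ≤ (C *ᵥ v) ⬝ᵥ (C *ᵥ v)) (hTs : (P - a • (1 : Matrix (Fin K) (Fin K) ℝ) - Jm).IsSymm)
    (hγ : 0 ≤ (c - κ₂) / κ₁ - θ) (x v : EuclideanSpace ℝ (Fin N)) :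
    2 * ((c - κ₂) / κ₁ - θ) * ‖v‖ ^ 2 ≤
      iteratedFDeriv ℝ 2 (fun z : EuclideanSpace ℝ (Fin N) =>
        ⟪z, toEuclideanCLM (𝕜 := ℝ) (Cᵀ * (P - a • (1 : Matrix (Fin K) (Fin K) ℝ) - Jm) * C) z⟫) x ![v, v] :=
  hessian_lower_of_coercive_sandwich _ C good hγ hgood hC
    (fun B hB => gamma0_assembly K₀ Q a H P Jm hQH hSH good Φ hκ₁ h1 h2 hJ B hB) hTs x v

/-- **WHICH MATRIX: PRINT's `Δ_k` OF (3.156), BY NAME** — `T := B10Eq54QuadForm.deltaK K C Δ Q a D Q_b a_b E = (Q_bG₁Q_bᵀ)⁻¹ − a_b·1 −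
(E + Eᵀ)`, `G₁⁻¹ = B9Eq3152.G1inv … = Δ₁ + DRD* + a_b·Q_bᵀQ_b` ((3.128), `G1inv_eq_delta1`).  `gamma0_assembly`'s `(H, P)` are INSTANTIATED as
print's `H₁ = G₁Q_bᵀ(Q_bG₁Q_bᵀ)⁻¹` ((3.129)) and `(Q_bG₁Q_bᵀ)⁻¹`, so `QH = 1`, `SH = QᵀP` are THEOREMS from two invertibility letters (print:
Thm 3.11 ⟹ `G₁` exists) and `Δ_k` symmetric from `K`, `C`, `Δ` symmetric (`deltaK_transpose`, `G1inv_transpose`); DISPLAYED stay (h1) (h2) (hJ)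
(now about print's own `K₀ = Δ₁ + DRD*`, `Q_b`, `E + Eᵀ`), the sandwich's `C` ∕ `good`, `0 ≤ γ₀′`.  Conclusion: floor `2γ₀′` for `Cᵀ·Δ_k·C` on
the road's fibre, at every point. [folklore] (bookkeeping over the Literature definitions; nothing of print asserted) -/
theorem hessian_lower_of_deltaK {n₀ m₀ b₀ K : ℕ} (Kb Cb : Matrix (Fin b₀) (Fin b₀) ℝ) (hKb : Kbᵀ = Kb) (hCb : Cbᵀ = Cb)
    (Δs : Matrix (Fin n₀) (Fin n₀) ℝ) (hΔs : Δs.IsSymm) (Qs : Matrix (Fin m₀) (Fin n₀) ℝ) (a : ℝ)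
    (D : Matrix (Fin b₀) (Fin n₀) ℝ) (Qb : Matrix (Fin K) (Fin b₀) ℝ) (ab : ℝ) (E : Matrix (Fin K) (Fin K) ℝ)
    (hG : IsUnit (G1inv Kb Cb Δs Qs a D Qb ab).det) (hM : IsUnit (Qb * (G1inv Kb Cb Δs Qs a D Qb ab)⁻¹ * Qbᵀ).det)
    (good : (Fin K → ℝ) → Prop) (Φ : (Fin K → ℝ) → ℝ) {κ₁ κ₂ c θ : ℝ} (hκ₁ : 0 < κ₁)
    (h1 : ∀ A : Fin b₀ → ℝ, Φ (Qb *ᵥ A) ≤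
      κ₁ * (A ⬝ᵥ ((delta1 Kb Cb Δs Qs a D + D * Literature.MathematicalPhysics.QuantumFieldTheory.Balaban1983to89.B9H163.R Δs Qs a * Dᵀ) *ᵥ A)) + κ₂ * ((Qb *ᵥ A) ⬝ᵥ (Qb *ᵥ A)))
    (h2 : ∀ B : Fin K → ℝ, good B → c * (B ⬝ᵥ B) ≤ Φ B)
    (hJ : ∀ B : Fin K → ℝ, |B ⬝ᵥ ((E + Eᵀ) *ᵥ B)| ≤ θ * (B ⬝ᵥ B))
    (C : Matrix (Fin K) (Fin N) ℝ) (hgood : ∀ v : Fin N → ℝ, good (C *ᵥ v))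
    (hC : ∀ v : Fin N → ℝ, v ⬝ᵥ v ≤ (C *ᵥ v) ⬝ᵥ (C *ᵥ v)) (hγ : 0 ≤ (c - κ₂) / κ₁ - θ) (x v : EuclideanSpace ℝ (Fin N)) :
    2 * ((c - κ₂) / κ₁ - θ) * ‖v‖ ^ 2 ≤
      iteratedFDeriv ℝ 2 (fun z : EuclideanSpace ℝ (Fin N) =>
        ⟪z, toEuclideanCLM (𝕜 := ℝ) (Cᵀ * deltaK Kb Cb Δs Qs a D Qb ab E * C) z⟫) x ![v, v] := by
  have hQH : Qb * ((G1inv Kb Cb Δs Qs a D Qb ab)⁻¹ * Qbᵀ * (Qb * (G1inv Kb Cb Δs Qs a D Qb ab)⁻¹ * Qbᵀ)⁻¹) = 1 := by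
    rw [← Matrix.mul_assoc, ← Matrix.mul_assoc, Matrix.mul_nonsing_inv _ hM]
  have hSH : (delta1 Kb Cb Δs Qs a D + D * Literature.MathematicalPhysics.QuantumFieldTheory.Balaban1983to89.B9H163.R Δs Qs a * Dᵀ + ab • (Qbᵀ * Qb)) *
      ((G1inv Kb Cb Δs Qs a D Qb ab)⁻¹ * Qbᵀ * (Qb * (G1inv Kb Cb Δs Qs a D Qb ab)⁻¹ * Qbᵀ)⁻¹) =
      Qbᵀ * (Qb * (G1inv Kb Cb Δs Qs a D Qb ab)⁻¹ * Qbᵀ)⁻¹ := by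
    rw [← G1inv_eq_delta1, Matrix.mul_assoc, Matrix.mul_nonsing_inv_cancel_left _ _ hG]
  have hT : deltaK Kb Cb Δs Qs a D Qb ab E =
      (Qb * (G1inv Kb Cb Δs Qs a D Qb ab)⁻¹ * Qbᵀ)⁻¹ - ab • (1 : Matrix (Fin K) (Fin K) ℝ) - (E + Eᵀ) := rfl
  have hTs : ((Qb * (G1inv Kb Cb Δs Qs a D Qb ab)⁻¹ * Qbᵀ)⁻¹ - ab • (1 : Matrix (Fin K) (Fin K) ℝ) - (E + Eᵀ)).IsSymm := by
    rw [← hT]; exact deltaK_transpose Kb Cb Δs Qs a D Qb ab E (G1inv_transpose Kb Cb hKb hCb Δs Qs a hΔs D Qb ab)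
  rw [hT]
  exact hessian_lower_of_gamma0_assembly _ Qb ab _ _ (E + Eᵀ) hQH hSH good Φ hκ₁ h1 h2 hJ C hgood hC hTs hγ x v

/-- **… AND WITH THE PERTURBATION, ON THE WINDOW**: `QGQInverse.Coercive M γ` (`M` symmetric), `P` `C²` at the points of `K` with
`−h‖v‖² ≤ D²P(x)[v, v]` on `K` ⟹ `(2γ − h)‖v‖² ≤ D²(⟪·, M̂·⟫ + P)(x)[v, v]` on `K`. [folklore] -/
theorem hessianOn_lower_of_coercive_add {M : Matrix (Fin N) (Fin N) ℝ} (hM : M.IsSymm) {γ h : ℝ} (hγ : QGQInverse.Coercive M γ)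
    {K : Set (EuclideanSpace ℝ (Fin N))} {P : EuclideanSpace ℝ (Fin N) → ℝ} (hP : ∀ x ∈ K, ContDiffAt ℝ 2 P x)
    (hH : ∀ x ∈ K, ∀ v : EuclideanSpace ℝ (Fin N), -h * ‖v‖ ^ 2 ≤ iteratedFDeriv ℝ 2 P x ![v, v]) :
    ∀ x ∈ K, ∀ v : EuclideanSpace ℝ (Fin N), (2 * γ - h) * ‖v‖ ^ 2 ≤
      iteratedFDeriv ℝ 2 (fun z : EuclideanSpace ℝ (Fin N) => ⟪z, toEuclideanCLM (𝕜 := ℝ) M z⟫ + P z) x ![v, v] :=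
  hessianOn_quadratic_add_lower _ (inner_toEuclideanCLM_symm hM) ((coercive_iff_inner M γ).1 hγ) hP hH

end Junction

/-! ## §6 Toy: `M = c·1` — the hypotheses are jointly inhabited and the floor `2c` is attained (`example`) -/
/-- The scalar matrix `c·1` is `c`-coercive (with equality). [folklore] -/
theorem coercive_smul_one (c : ℝ) : QGQInverse.Coercive (c • (1 : Matrix (Fin N) (Fin N) ℝ)) c := by
  intro x
  rw [smul_mulVec, one_mulVec, dotProduct_smul, smul_eq_mul]

example (c : ℝ) (x v : EuclideanSpace ℝ (Fin N)) :
    iteratedFDeriv ℝ 2 (fun z : EuclideanSpace ℝ (Fin N) => ⟪z, toEuclideanCLM (𝕜 := ℝ) (c • (1 : Matrix (Fin N) (Fin N) ℝ)) z⟫) x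
        ![v, v] = 2 * c * ‖v‖ ^ 2 := by
  rw [iteratedFDeriv_two_quadratic _ (inner_toEuclideanCLM_symm (Matrix.isSymm_one.smul c)), inner_toEuclideanCLM,
    smul_mulVec, one_mulVec, dotProduct_smul, smul_eq_mul, dotProduct_self_eq_norm_sq]
  ring

end Summit.QuantumFields.BalabanUV.T4Continuum.NE7b.CoerciveFluctuationFloor
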